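import Literature.MathematicalPhysics.QuantumFieldTheory.Balaban1983to89.B9SectBGpReadingsY
import Literature.MathematicalPhysics.QuantumFieldTheory.Balaban1983to89.B9Ineq347Reading
import Literature.MathematicalPhysics.QuantumFieldTheory.Balaban1983to89.B9RWSums347DefiniteFacesWindow
import Literature.MathematicalPhysics.QuantumFieldTheory.Balaban1983to89.B9Ineq347GpAtLetters
import Literature.MathematicalPhysics.QuantumFieldTheory.Balaban1983to89.Node00.OpsYRead342

/-!
# `Balaban1983to89.B9Ineq347SiteReadingY` — B9 p. 398 «the global inequalities (3.47) are consequences of the local ones (3.42) and Lemma 2.1»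
# FOR NODE 00's SITE-SECTOR READING `kernelFamilyS` AT A MEMBER WITH A SECTION OF `β`, AT EVERY CONFIGURATION

T. Bałaban, *Propagators for lattice gauge theories in a background field*, Commun. Math. Phys. **99** (1985) 389–434
[`Balaban1985BackgroundPropagators`, "B9"], (3.41)–(3.42) p. 397, (3.47) p. 398; T. Bałaban, *Propagators and renormalization transformations for lattice
gauge theories. II*, Commun. Math. Phys. **96** (1984) 223–250 [`Balaban1984PropagatorsII`, "[4]"], (2.52) p. 232, Lemma 2.1 (2.60)–(2.61) p. 234.

statement-level skeleton of published theorems with citation tags; proofs where landed; nothing here is a claim about the Yang–Mills mass gap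

THE PRINTED SENTENCE (p. 398): *«It is easy to see that the global inequalities (3.47) are consequences of the local ones (3.42) and Lemma 2.1.»*  The tree's
kernel-checked form of it, `B9Ineq347Reading.globBlockOn_of_eBlock` (n06-h), is CONDITIONAL on the reading axioms `GlobReading K P U res` of the kernel family
(block pieces `res`, their supports and sizes, sub-additivity of the (3.42) readings, «the smallest C such that …» for (3.47)).  THIS FILE DISCHARGES those
axioms for def-Y's site-sector reading `Node00.kernelFamilyS i B cfg O par` — ANY backgrounds record `B`, ANY decoding `cfg`, ANY site operator `O`, ANY
transporter `par`, AT ANY configuration — at a member carrying a SECTION `ιB` of `β` (every block of `𝔅_k` is the carrier block `β(ιB s)`; at cornered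
members the axioms fail for the same reason as `B9GlobReadingOrphan`), and concludes (3.47) from (3.42) at such members above an `M`-threshold depending on
the rate only.  Use (pub-ymgap N06 row 13, seat dag-n06-c gen 8): the (3.47) member of the Sect.-B output `G′(U′U)` at the PRODUCT configuration, read by
the record, from the converted (3.42) block there (`B9SectBGpTransferConvY.hconv_at`) — the global member needs no letters of its own.

WHAT IS IN THE FILE (0 sorry; standard axioms; two small `def`s = the block pieces).
* §1 `pieceY ιB b f` (the piece of a site function on the block labelled `b`: `Δ(y′)λ` of [4] (2.52)), `resY` (on the sum-typed arguments), `sum_pieceY`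
  (λ = Σ_{y′} Δ(y′)λ), support and size (`suppIn_pieceY`, `supNorm_pieceY_le`: |Δ(y′)λ| ≦ (L^{j′}η)^γ|λ|_{(γ)}).
* §2 sub-additivity of the four (3.42) readings along finite sums (`supBlkS_sum_le`, `supBlkS'_sum_le`, `eLatS_sum_le`), the uniform bound over the unit
  ball (`exists_ball_bound_eLatS`), and ★ `e_subadd_kernelFamilyS`.
* §3 ★ `glob_le_kernelFamilyS` («the smallest number C such that …»: the weighted sups (3.47) are ≦ C as soon as every block reading is ≦ C·[…]_n·(Lʲη)^γ).
* §4 ★★ `globReading_kernelFamilyS` — `GlobReading (kernelFamilyS …) (site arguments) c (resY ιB)`; ★★ `globBlock_kernelFamilyS_of_eBlock` — for every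
  rate `δ₀ > 0` ONE threshold `Mg` and ONE constant `Cg ≥ 0` (n06-k's Lemma 2.1 window at `R` read as `1`, exponent split `α = 1/2`) such that at every
  member with a section above `Mg`: `EBlock (kernelFamilyS …) B₀ δ₀ c → GlobBlock (kernelFamilyS …) (B₀·Cg) c`, every `B c cfg O par`, `B₀ ≥ 0`.

HONEST SCOPE.  Print's «easy to see» bookkeeping for one concrete reading; the analytic input is [4] Lemma 2.1 as supplied in the tree
(`B9RWSums347DefiniteFacesWindow.lemma21Window_geo9Y`).  Nothing of Theorem 3.1 is asserted (the (3.42) block is the HYPOTHESIS); per-member, under the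
section hypothesis `hι` (satisfiable exactly at corner-free members, `B9SectBCodedClassY.exists_memberY_surjective_beta`).  COUNT-NEUTRAL; N06 NOT
discharged; one finite lattice programme — nothing continuum ∕ OS ∕ mass-gap ∕ Clay.  Cell `pub-ymgap` (HUMAN RULING D-0062), Track A node N06 [B9],
row 13, 2026-08-28.

RELATED IN THE TREE, NOT DUPLICATED: `B9Ineq347Reading` (`GlobReading`, `globBlockOn_of_eBlock` — USED), `B9Ineq347GpAtLetters` ((3.47) at `U = 1` from [4]
(2.67) directly — a different route), `B9Ineq347CoReadingAtLetters` (the bond sector's co-reading), `B9GlobReadingOrphan` (the negative at orphan blocks),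
`Node00.OpsYRead342` ∕ `B9SectBGpReadingsY` (reading API — USED BY NAME).
-/

namespace Literature.MathematicalPhysics.QuantumFieldTheory.Balaban1983to89.B9Ineq347SiteReadingY

open Literature.MathematicalPhysics.QuantumFieldTheory.Balaban1983to89
open Literature.MathematicalPhysics.QuantumFieldTheory.Balaban1983to89.B6KLevelCensusIndexV1 (KIdx kGeo)
open Literature.MathematicalPhysics.QuantumFieldTheory.Balaban1983to89.B6Ineq2142KLevelV1 (β lvl beta_level)
open Literature.MathematicalPhysics.QuantumFieldTheory.Balaban1983to89.B6Prop22KLevelCensusEta (epow)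
open Literature.MathematicalPhysics.QuantumFieldTheory.Balaban1983to89.B6RandomWalk (Ineq260 Ineq261)
open Literature.MathematicalPhysics.QuantumFieldTheory.Balaban1983to89.B9Thm34Ext (toB6)
open Literature.MathematicalPhysics.QuantumFieldTheory.Balaban1983to89.B9FromB6 (EBlock GlobBlock)
open Literature.MathematicalPhysics.QuantumFieldTheory.Balaban1983to89.B9ResidualEntriesAtOne (GlobBlockOn)
open Literature.MathematicalPhysics.QuantumFieldTheory.Balaban1983to89.B9Ineq347Reading (GlobReading globBlockOn_of_eBlock)
open Literature.MathematicalPhysics.QuantumFieldTheory.Balaban1983to89.B9PinMembersKLevelV1 (MemberY geo9Y)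
open Literature.MathematicalPhysics.QuantumFieldTheory.Balaban1983to89.B9SectBGpLettersY (blkC)
open Literature.MathematicalPhysics.QuantumFieldTheory.Balaban1983to89.B9SectBGpReadingsY (exists_ball_bound supNorm_inl_le suppIn_inl_of_blkC
  norm_le_supBlkS norm_le_supBlkS' etaS_eq_eta)
open Literature.MathematicalPhysics.QuantumFieldTheory.Balaban1983to89.B9Thm314WholeExpansionReads (le_iSup_ball)
open Literature.MathematicalPhysics.QuantumFieldTheory.Balaban1983to89.B9Ineq349SiteComposite (cdSL cdsSL cdSL_apply cdsSL_apply supBlkS_le supBlkS'_le)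
open Literature.MathematicalPhysics.QuantumFieldTheory.Balaban1983to89.B9Ineq347GpAtLetters (abs_le_wNormS_mul_scale wNormSY_le_of_pointwise)
open Literature.MathematicalPhysics.QuantumFieldTheory.Balaban1983to89.B9RWSums347DefiniteFacesWindow (lemma21Window_geo9Y)
open Literature.MathematicalPhysics.QuantumFieldTheory.Balaban1983to89.B9GeoLemma21KLevelV1 (geo9Y_len_pos geo9K_eta_pos geo9K_one_le_L)
open Literature.MathematicalPhysics.QuantumFieldTheory.Balaban1983to89.B9GeoNormsKLevelV1 (wNormS geo9K_wNorm_nonneg)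
open Literature.MathematicalPhysics.QuantumFieldTheory.Balaban1983to89.Node00 (SiteY BlkY IBondY CfgY KLoc BallY SiteOpY SiteParY liftY liftY_apply supBlkS
  supBlkS' cdS cdsS lapS lapSL etaS eLatS wNormSY kernelFamilyS)
open Literature.MathematicalPhysics.QuantumFieldTheory.Balaban1983to89.Node00 (lapSL_apply liftY_add)

variable {𝔸 : Type} [NormedRing 𝔸] [NormedAlgebra ℂ 𝔸] [CompleteSpace 𝔸] [FiniteDimensional ℝ 𝔸]
variable {d ℓ : ℕ} {hd : 1 ≤ d + 1} {hL : Odd (ℓ + 1) ∧ 1 < ℓ + 1} {b₀ b₁ : ℝ} {Mstar : ℕ}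

/-! ## §1 Block pieces of a site argument -/

section Pieces

variable (x : MemberY d ℓ hd hL b₀ b₁ Mstar) (ιB : BlkY x.toKIdx → IBondY x.toKIdx)

open Classical in
/-- **THE BLOCK PIECE `Δ(y′)λ`** of a site function: `f` on the block labelled `b` (`ιB (Δ(z)) = b`), `0` elsewhere. [cite: Balaban1984PropagatorsII, (2.52) p.232] -/
def pieceY (b : IBondY x.toKIdx) (f : SiteY x.toKIdx → ℝ) : SiteY x.toKIdx → ℝ := fun z => if blkC x.toKIdx ιB z = b then f z else 0

/-- **THE BLOCK PIECES ON THE SUM-TYPED ARGUMENTS** (site functions cut to the block; bond functions untouched — they are not read by the site sector).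
[cite: Balaban1984PropagatorsII, (2.52) p.232; Balaban1985BackgroundPropagators, (3.42) p.397 («supp λ ⊂ Δ(y′)»)] -/
def resY (b : IBondY x.toKIdx) : KLoc x.toKIdx → KLoc x.toKIdx
  | .inl f => .inl (pieceY x ιB b f)
  | .inr J => .inr J

omit [NormedAlgebra ℂ 𝔸] [CompleteSpace 𝔸] [FiniteDimensional ℝ 𝔸] in
/-- the piece vanishes off its block. [cite: Balaban1984PropagatorsII, (2.52) p.232, bookkeeping] -/
theorem pieceY_off {b : IBondY x.toKIdx} {f : SiteY x.toKIdx → ℝ} {z : SiteY x.toKIdx} (h : blkC x.toKIdx ιB z ≠ b) : pieceY x ιB b f z = 0 := by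
  classical
  exact if_neg h

omit [NormedAlgebra ℂ 𝔸] [CompleteSpace 𝔸] [FiniteDimensional ℝ 𝔸] in
/-- the piece on its block is the function. [cite: Balaban1984PropagatorsII, (2.52) p.232, bookkeeping] -/
theorem pieceY_on {b : IBondY x.toKIdx} {f : SiteY x.toKIdx → ℝ} {z : SiteY x.toKIdx} (h : blkC x.toKIdx ιB z = b) : pieceY x ιB b f z = f z := by
  classical
  exact if_pos h

omit [NormedAlgebra ℂ 𝔸] [CompleteSpace 𝔸] [FiniteDimensional ℝ 𝔸] in
/-- the pieces are pointwise dominated by the function. [cite: Balaban1984PropagatorsII, (2.52) p.232, bookkeeping] -/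
theorem abs_pieceY_le (b : IBondY x.toKIdx) (f : SiteY x.toKIdx → ℝ) (z : SiteY x.toKIdx) : |pieceY x ιB b f z| ≤ |f z| := by
  classical
  unfold pieceY
  split_ifs
  · exact le_rfl
  · rw [abs_zero]; exact abs_nonneg _

omit [NormedAlgebra ℂ 𝔸] [CompleteSpace 𝔸] [FiniteDimensional ℝ 𝔸] in
/-- **λ = Σ_{y′} Δ(y′)λ** over the labels (each site lies in exactly one labelled block). [cite: Balaban1984PropagatorsII, (2.52) p.232] -/
theorem sum_pieceY [inst : Fintype (geo9Y x).Site] (f : SiteY x.toKIdx → ℝ) : ∑ b : (geo9Y x).Site, pieceY x ιB b f = f := by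
  classical
  funext z
  rw [Finset.sum_apply]
  exact (Finset.sum_eq_single (blkC x.toKIdx ιB z : (geo9Y x).Site) (fun b _ hb => pieceY_off x ιB (Ne.symm hb))
    (fun h => absurd (@Finset.mem_univ _ inst _) h)).trans (pieceY_on x ιB rfl)

omit [FiniteDimensional ℝ 𝔸] in
/-- **supp Δ(y′)λ ⊂ Δ(y′)** in the reading's sense (the labelling is a section of `β`). [cite: Balaban1985BackgroundPropagators, (3.42) p.397 («supp λ ⊂ Δ(y′)»)] -/
theorem suppIn_pieceY [Fintype (geo9Y x).Site] (hι : ∀ s : BlkY x.toKIdx, β x.toKIdx.hN x.toKIdx.D x.toKIdx.hk (ιB s) = s) (b : IBondY x.toKIdx)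
    (f : SiteY x.toKIdx → ℝ) : (geo9Y x).suppIn (.inl (pieceY x ιB b f)) b :=
  suppIn_inl_of_blkC x ιB hι fun _ h => pieceY_off x ιB h

omit [NormedRing 𝔸] [NormedAlgebra ℂ 𝔸] [CompleteSpace 𝔸] [FiniteDimensional ℝ 𝔸] in
/-- the length of the labelled block of a site is the printed scale `L^{j(z)}η`. [cite: Balaban1985BackgroundPropagators, (3.41) p.397 («Lʲη»), dictionary] -/
theorem len_blkC_eq (hι : ∀ s : BlkY x.toKIdx, β x.toKIdx.hN x.toKIdx.D x.toKIdx.hk (ιB s) = s) (z : SiteY x.toKIdx) :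
    (geo9Y x).len (blkC x.toKIdx ιB z) = ((ℓ : ℝ) + 1) ^ (x.D.lev z.1) * |x.cf|⁻¹ := by
  have hk1 : 1 ≤ x.k := le_trans one_le_two x.hk2
  show (kGeo x.toKIdx).L ^ lvl x.hN x.D x.hk (ιB (B6Geom246MultiLevelBox.blkOf x.D.toDomains z)) * (kGeo x.toKIdx).eta = _
  rw [← beta_level x.hN x.D x.hk hk1, hι]
  push_cast
  rfl

omit [FiniteDimensional ℝ 𝔸] in
/-- **|Δ(y′)λ| ≦ (L^{j′}η)^γ·|λ|_{(γ)}** (the sentence after (3.41)). [cite: Balaban1985BackgroundPropagators, (3.41) p.397] -/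
theorem supNorm_pieceY_le [Fintype (geo9Y x).Site] (hι : ∀ s : BlkY x.toKIdx, β x.toKIdx.hN x.toKIdx.D x.toKIdx.hk (ιB s) = s) (b : IBondY x.toKIdx)
    (f : SiteY x.toKIdx → ℝ) (γ : ℝ) :
    (geo9Y x).supNorm (.inl (pieceY x ιB b f)) ≤ (geo9Y x).len b ^ γ * (geo9Y x).wNorm γ (.inl f) := by
  have hw : 0 ≤ (geo9Y x).wNorm γ (.inl f) := geo9K_wNorm_nonneg x.toKIdx γ _
  have hlen : 0 ≤ (geo9Y x).len b := (geo9Y_len_pos x b).le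
  refine supNorm_inl_le x (mul_nonneg (Real.rpow_nonneg hlen γ) hw) fun z => ?_
  by_cases hz : blkC x.toKIdx ιB z = b
  · rw [pieceY_on x ιB hz]
    have h := abs_le_wNormS_mul_scale x.toKIdx γ f z
    rw [← len_blkC_eq x ιB hι z, hz, mul_comm] at h
    exact h
  · rw [pieceY_off x ιB hz, abs_zero]
    exact mul_nonneg (Real.rpow_nonneg hlen γ) hw

end Pieces

/-! ## §2 Sub-additivity of the (3.42) readings along finite sums -/

section Subadd

variable (x : MemberY d ℓ hd hL b₀ b₁ Mstar)

omit [NormedAlgebra ℂ 𝔸] [CompleteSpace 𝔸] [FiniteDimensional ℝ 𝔸] in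
/-- a block sup is nonnegative. [cite: Balaban1985BackgroundPropagators, (3.42) p.397, bookkeeping] -/
theorem supBlkS_nonneg (s : BlkY x.toKIdx) (Ψ : SiteY x.toKIdx → 𝔸) : 0 ≤ supBlkS x.toKIdx s Ψ := by
  classical
  unfold supBlkS
  exact Real.iSup_nonneg fun z => by split_ifs <;> first | exact norm_nonneg _ | exact le_rfl

omit [NormedAlgebra ℂ 𝔸] [CompleteSpace 𝔸] [FiniteDimensional ℝ 𝔸] in
/-- a directional block sup is nonnegative. [cite: Balaban1985BackgroundPropagators, (3.42) p.397, bookkeeping] -/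
theorem supBlkS'_nonneg (s : BlkY x.toKIdx) (Ψ : Fin (d + 1) → SiteY x.toKIdx → 𝔸) : 0 ≤ supBlkS' x.toKIdx s Ψ := by
  classical
  unfold supBlkS'
  exact Real.iSup_nonneg fun p => by split_ifs <;> first | exact norm_nonneg _ | exact le_rfl

omit [NormedAlgebra ℂ 𝔸] [CompleteSpace 𝔸] [FiniteDimensional ℝ 𝔸] in
/-- **the block sup is sub-additive along finite sums.** [cite: Balaban1985BackgroundPropagators, (3.42) p.397; Balaban1984PropagatorsII, (2.52) p.232] -/
theorem supBlkS_sum_le {β' : Type} (S : Finset β') (s : BlkY x.toKIdx) (Ψ : β' → SiteY x.toKIdx → 𝔸) :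
    supBlkS x.toKIdx s (∑ b ∈ S, Ψ b) ≤ ∑ b ∈ S, supBlkS x.toKIdx s (Ψ b) := by
  refine supBlkS_le x.toKIdx s _ (Finset.sum_nonneg fun b _ => supBlkS_nonneg x s (Ψ b)) fun z hz => ?_
  rw [Finset.sum_apply]
  exact (norm_sum_le _ _).trans (Finset.sum_le_sum fun b _ => norm_le_supBlkS x.toKIdx s (Ψ b) hz)

omit [NormedAlgebra ℂ 𝔸] [CompleteSpace 𝔸] [FiniteDimensional ℝ 𝔸] in
/-- **the directional block sup is sub-additive along finite sums.** [cite: Balaban1985BackgroundPropagators, (3.42) p.397; Balaban1984PropagatorsII, (2.52) p.232] -/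
theorem supBlkS'_sum_le {β' : Type} (S : Finset β') (s : BlkY x.toKIdx) (Ψ : β' → Fin (d + 1) → SiteY x.toKIdx → 𝔸) :
    supBlkS' x.toKIdx s (fun μ z => ∑ b ∈ S, Ψ b μ z) ≤ ∑ b ∈ S, supBlkS' x.toKIdx s (Ψ b) := by
  refine supBlkS'_le x.toKIdx s _ (Finset.sum_nonneg fun b _ => supBlkS'_nonneg x s (Ψ b)) fun z μ hz => ?_
  exact (norm_sum_le _ _).trans (Finset.sum_le_sum fun b _ => norm_le_supBlkS' x.toKIdx s (Ψ b) μ hz)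

omit [FiniteDimensional ℝ 𝔸] in
/-- **THE FOUR (3.42) READINGS ARE SUB-ADDITIVE ALONG FINITE SUMS OF ARGUMENTS** (linearity of `O(U)`, `∇_U`, `∇*_U`, `Δ_U` and of the block sups).
[cite: Balaban1985BackgroundPropagators, (3.42) p.397; Balaban1984PropagatorsII, (2.52) p.232] -/
theorem eLatS_sum_le {β' : Type} (S : Finset β') (O : SiteOpY 𝔸 x.toKIdx) (U : CfgY 𝔸 x.toKIdx) (Λ : β' → SiteY x.toKIdx → 𝔸)
    (s : BlkY x.toKIdx) (n : Fin 4) :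
    eLatS x.toKIdx O U (∑ b ∈ S, Λ b) s n ≤ ∑ b ∈ S, eLatS x.toKIdx O U (Λ b) s n := by
  have hO : O U (∑ b ∈ S, Λ b) = ∑ b ∈ S, O U (Λ b) := map_sum _ _ _
  match n with
  | 0 =>
    show supBlkS x.toKIdx s (O U (∑ b ∈ S, Λ b)) ≤ ∑ b ∈ S, supBlkS x.toKIdx s (O U (Λ b))
    rw [hO]
    exact supBlkS_sum_le x S s _
  | 1 =>
    show supBlkS' x.toKIdx s (fun μ => cdS x.toKIdx U μ (O U (∑ b ∈ S, Λ b))) ≤ ∑ b ∈ S, supBlkS' x.toKIdx s (fun μ => cdS x.toKIdx U μ (O U (Λ b)))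
    have h : (fun μ => cdS x.toKIdx U μ (O U (∑ b ∈ S, Λ b))) = fun μ z => ∑ b ∈ S, cdS x.toKIdx U μ (O U (Λ b)) z := by
      funext μ z
      rw [hO, ← cdSL_apply, map_sum, Finset.sum_apply]
      simp only [cdSL_apply]
    rw [h]
    exact supBlkS'_sum_le x S s _
  | 2 =>
    show supBlkS' x.toKIdx s (fun μ => O U (cdsS x.toKIdx U μ (∑ b ∈ S, Λ b))) ≤ ∑ b ∈ S, supBlkS' x.toKIdx s (fun μ => O U (cdsS x.toKIdx U μ (Λ b)))
    have h : (fun μ => O U (cdsS x.toKIdx U μ (∑ b ∈ S, Λ b))) = fun μ z => ∑ b ∈ S, O U (cdsS x.toKIdx U μ (Λ b)) z := by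
      funext μ z
      rw [← cdsSL_apply, map_sum, map_sum, Finset.sum_apply]
      simp only [cdsSL_apply]
    rw [h]
    exact supBlkS'_sum_le x S s _
  | 3 =>
    show supBlkS x.toKIdx s (lapS x.toKIdx U (O U (∑ b ∈ S, Λ b))) ≤ ∑ b ∈ S, supBlkS x.toKIdx s (lapS x.toKIdx U (O U (Λ b)))
    have h : lapS x.toKIdx U (O U (∑ b ∈ S, Λ b)) = ∑ b ∈ S, lapS x.toKIdx U (O U (Λ b)) := by
      rw [hO, ← lapSL_apply, map_sum]
      simp only [lapSL_apply]
    rw [h]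
    exact supBlkS_sum_le x S s _

/-- the four readings of `O(U)(g ⊗ E)` are bounded uniformly over the unit ball (finite dimension). [cite: Balaban1985BackgroundPropagators, (3.42) p.397, bookkeeping] -/
theorem exists_ball_bound_eLatS (O : SiteOpY 𝔸 x.toKIdx) (U : CfgY 𝔸 x.toKIdx) (g : SiteY x.toKIdx → ℝ) (s : BlkY x.toKIdx) (n : Fin 4) :
    ∃ C : ℝ, ∀ E : BallY 𝔸, eLatS x.toKIdx O U (liftY g (E : 𝔸)) s n ≤ C := by
  obtain ⟨C₀, hC₀, h₀⟩ := exists_ball_bound x ((O U).restrictScalars ℝ) g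
  have hL : ∀ μ, ∃ C, 0 ≤ C ∧ ∀ (E : BallY 𝔸) z, ‖cdS x.toKIdx U μ (O U (liftY g (E : 𝔸))) z‖ ≤ C := fun μ =>
    exists_ball_bound x ((cdSL x.toKIdx U μ ∘ₗ O U).restrictScalars ℝ) g
  have hRs : ∀ μ, ∃ C, 0 ≤ C ∧ ∀ (E : BallY 𝔸) z, ‖O U (cdsS x.toKIdx U μ (liftY g (E : 𝔸))) z‖ ≤ C := fun μ =>
    exists_ball_bound x ((O U ∘ₗ cdsSL x.toKIdx U μ).restrictScalars ℝ) g
  have hΔ : ∃ C, 0 ≤ C ∧ ∀ (E : BallY 𝔸) z, ‖lapS x.toKIdx U (O U (liftY g (E : 𝔸))) z‖ ≤ C :=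
    exists_ball_bound x ((lapSL x.toKIdx U ∘ₗ O U).restrictScalars ℝ) g
  choose CL hCL0 hCL using hL
  choose CRs hCRs0 hCRs using hRs
  obtain ⟨CΔ, hCΔ0, hCΔ⟩ := hΔ
  have hsumL : ∀ μ, CL μ ≤ ∑ ν, CL ν := fun μ => Finset.single_le_sum (fun ν _ => hCL0 ν) (Finset.mem_univ μ)
  have hsumRs : ∀ μ, CRs μ ≤ ∑ ν, CRs ν := fun μ => Finset.single_le_sum (fun ν _ => hCRs0 ν) (Finset.mem_univ μ)
  match n with
  | 0 => exact ⟨C₀, fun E => supBlkS_le x.toKIdx s _ hC₀ fun w _ => h₀ E w⟩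
  | 1 => exact ⟨∑ ν, CL ν, fun E => supBlkS'_le x.toKIdx s _ (Finset.sum_nonneg fun ν _ => hCL0 ν) fun w μ _ => (hCL μ E w).trans (hsumL μ)⟩
  | 2 => exact ⟨∑ ν, CRs ν, fun E => supBlkS'_le x.toKIdx s _ (Finset.sum_nonneg fun ν _ => hCRs0 ν) fun w μ _ => (hCRs μ E w).trans (hsumRs μ)⟩
  | 3 => exact ⟨CΔ, fun E => supBlkS_le x.toKIdx s _ hCΔ0 fun w _ => hCΔ E w⟩

omit [FiniteDimensional ℝ 𝔸] in
/-- the four readings are nonnegative. [cite: Balaban1985BackgroundPropagators, (3.42) p.397, bookkeeping] -/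
theorem eLatS_nonneg (O : SiteOpY 𝔸 x.toKIdx) (U : CfgY 𝔸 x.toKIdx) (Λ : SiteY x.toKIdx → 𝔸) (s : BlkY x.toKIdx) (n : Fin 4) :
    0 ≤ eLatS x.toKIdx O U Λ s n := by
  match n with
  | 0 => exact supBlkS_nonneg x s (O U Λ)
  | 1 => exact supBlkS'_nonneg x s (fun μ => cdS x.toKIdx U μ (O U Λ))
  | 2 => exact supBlkS'_nonneg x s (fun μ => O U (cdsS x.toKIdx U μ Λ))
  | 3 => exact supBlkS_nonneg x s (lapS x.toKIdx U (O U Λ))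

omit [CompleteSpace 𝔸] [FiniteDimensional ℝ 𝔸] in
/-- the amplitude lift is additive along finite sums: `(Σ_b f_b) ⊗ E = Σ_b (f_b ⊗ E)`. [cite: Balaban1985BackgroundPropagators, (3.39) p.397, bookkeeping] -/
theorem liftY_sum {β' : Type} (S : Finset β') (f : β' → SiteY x.toKIdx → ℝ) (E : 𝔸) :
    liftY (∑ b ∈ S, f b) E = ∑ b ∈ S, liftY (f b) E := by
  classical
  induction S using Finset.induction_on with
  | empty =>
    funext z
    simp [liftY_apply]
  | insert a S ha ih =>
    rw [Finset.sum_insert ha, Finset.sum_insert ha, liftY_add, ih]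

/-- ★ **SUB-ADDITIVITY OF THE (3.42) READINGS OF `kernelFamilyS` ALONG λ = Σ_{y′} Δ(y′)λ** (the `e_subadd` axiom of `GlobReading`), at a member with a section
`ιB` of `β`, every `B`, `cfg`, `O`, `par`, every configuration. [cite: Balaban1985BackgroundPropagators, (3.42) p.397; Balaban1984PropagatorsII, (2.52) p.232] -/
theorem e_subadd_kernelFamilyS [Fintype (geo9Y x).Site] (ιB : BlkY x.toKIdx → IBondY x.toKIdx) (B : B9.Backgrounds) (cfg : B.Cfg → CfgY 𝔸 x.toKIdx)
    (O : SiteOpY 𝔸 x.toKIdx) (par : SiteParY 𝔸 x.toKIdx) (c : B.Cfg) (n : Fin 4) (f : SiteY x.toKIdx → ℝ) (y : IBondY x.toKIdx) :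
    (kernelFamilyS x.toKIdx B cfg O par).e n c (.inl f) y ≤
      ∑ b : (geo9Y x).Site, (kernelFamilyS x.toKIdx B cfg O par).e n c (resY x ιB b (.inl f)) y := by
  have hη0 : 0 < etaS x.toKIdx := by rw [etaS_eq_eta]; exact geo9K_eta_pos x.toKIdx
  have hK : ∀ g : SiteY x.toKIdx → ℝ, (kernelFamilyS x.toKIdx B cfg O par).e n c (.inl g) y =
      etaS x.toKIdx ^ (epow n) * ⨆ E : BallY 𝔸, eLatS x.toKIdx O (cfg c) (liftY g (E : 𝔸)) (β x.toKIdx.hN x.toKIdx.D x.toKIdx.hk y) n := fun g => rfl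
  have hres : ∀ b : (geo9Y x).Site, resY x ιB b (.inl f) = .inl (pieceY x ιB b f) := fun b => rfl
  simp only [hres, hK]
  rw [← Finset.mul_sum]
  refine mul_le_mul_of_nonneg_left ?_ (pow_nonneg hη0.le _)
  set s := β x.toKIdx.hN x.toKIdx.D x.toKIdx.hk y
  have hbd : ∀ b : (geo9Y x).Site, ∃ C : ℝ, ∀ E : BallY 𝔸, eLatS x.toKIdx O (cfg c) (liftY (pieceY x ιB b f) (E : 𝔸)) s n ≤ C := fun b =>
    exists_ball_bound_eLatS x O (cfg c) (pieceY x ιB b f) s n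
  have hsum_nonneg : 0 ≤ ∑ b : (geo9Y x).Site, ⨆ E : BallY 𝔸, eLatS x.toKIdx O (cfg c) (liftY (pieceY x ιB b f) (E : 𝔸)) s n :=
    Finset.sum_nonneg fun b _ => Real.iSup_nonneg fun E => eLatS_nonneg x O (cfg c) _ s n
  refine Real.iSup_le (fun E => ?_) hsum_nonneg
  have hdec : liftY f (E : 𝔸) = ∑ b : (geo9Y x).Site, liftY (pieceY x ιB b f) (E : 𝔸) := by
    rw [← liftY_sum x Finset.univ (fun b : (geo9Y x).Site => pieceY x ιB b f) (E : 𝔸), sum_pieceY x ιB f]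
  rw [hdec]
  refine (eLatS_sum_le x Finset.univ O (cfg c) _ s n).trans (Finset.sum_le_sum fun b _ => ?_)
  exact le_iSup_ball (A := fun E' : BallY 𝔸 => eLatS x.toKIdx O (cfg c) (liftY (pieceY x ιB b f) (E' : 𝔸)) s n) (hbd b) E

end Subadd

/-! ## §3 «The smallest number C such that …»: the (3.47) readings from block bounds -/

section GlobLe

variable (x : MemberY d ℓ hd hL b₀ b₁ Mstar) (ιB : BlkY x.toKIdx → IBondY x.toKIdx)

omit [CompleteSpace 𝔸] [FiniteDimensional ℝ 𝔸] in
/-- the norm of a real multiple. [cite: Balaban1985BackgroundPropagators, (3.47) p.398, bookkeeping] -/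
theorem norm_real_smul_eq {r : ℝ} (hr : 0 ≤ r) (X : 𝔸) : ‖((r : ℝ) : ℂ) • X‖ = r * ‖X‖ := by
  rw [norm_smul, Complex.norm_real, Real.norm_eq_abs, abs_of_nonneg hr]

/-- ★ **THE `glob_le` AXIOM FOR `kernelFamilyS`**: if every (3.42) block reading of the argument `f ⊗ ·` at the labelled blocks satisfies
`e_n ≦ C·[(Lʲη)², Lʲη, Lʲη, 1]_n·(Lʲη)^γ`, then the n-th (3.47) reading is `≦ C` — because every block is a labelled block (`ιB` a section of `β`) and the (3.47)
reading is the (3.41)-weighted sup of the same quantities, amplitude by amplitude. [cite: Balaban1985BackgroundPropagators, (3.41) p.397 («the smallest number C»), (3.47) p.398] -/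
theorem glob_le_kernelFamilyS [Fintype (geo9Y x).Site] (hι : ∀ s : BlkY x.toKIdx, β x.toKIdx.hN x.toKIdx.D x.toKIdx.hk (ιB s) = s)
    (B : B9.Backgrounds) (cfg : B.Cfg → CfgY 𝔸 x.toKIdx) (O : SiteOpY 𝔸 x.toKIdx) (par : SiteParY 𝔸 x.toKIdx) (c : B.Cfg) (n : Fin 4)
    (f : SiteY x.toKIdx → ℝ) (γ C : ℝ) (hC : 0 ≤ C)
    (h : ∀ y : IBondY x.toKIdx, (kernelFamilyS x.toKIdx B cfg O par).e n c (.inl f) y ≤ C * B9.pref4 ((geo9Y x).len y) n * (geo9Y x).len y ^ γ) :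
    (kernelFamilyS x.toKIdx B cfg O par).glob n c (.inl f) γ ≤ C := by
  have hη0 : 0 < etaS x.toKIdx := by rw [etaS_eq_eta]; exact geo9K_eta_pos x.toKIdx
  -- the block reading at the labelled block of `z`, below the sup over the ball, below the hypothesis
  have hKe : ∀ (z : SiteY x.toKIdx) (E : BallY 𝔸),
      etaS x.toKIdx ^ (epow n) * eLatS x.toKIdx O (cfg c) (liftY f (E : 𝔸)) (B6Geom246MultiLevelBox.blkOf x.D.toDomains z) n ≤
        C * B9.pref4 ((geo9Y x).len (blkC x.toKIdx ιB z)) n * (geo9Y x).len (blkC x.toKIdx ιB z) ^ γ := by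
    intro z E
    have hK : (kernelFamilyS x.toKIdx B cfg O par).e n c (.inl f) (blkC x.toKIdx ιB z) = etaS x.toKIdx ^ (epow n) *
        ⨆ E' : BallY 𝔸, eLatS x.toKIdx O (cfg c) (liftY f (E' : 𝔸)) (β x.toKIdx.hN x.toKIdx.D x.toKIdx.hk (blkC x.toKIdx ιB z)) n := rfl
    have hblk : β x.toKIdx.hN x.toKIdx.D x.toKIdx.hk (blkC x.toKIdx ιB z) = B6Geom246MultiLevelBox.blkOf x.D.toDomains z := by
      rw [blkC, hι]; rfl
    have h1 := h (blkC x.toKIdx ιB z)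
    rw [hK, hblk] at h1
    refine le_trans (mul_le_mul_of_nonneg_left ?_ (pow_nonneg hη0.le _)) h1
    exact le_iSup_ball (A := fun E' : BallY 𝔸 => eLatS x.toKIdx O (cfg c) (liftY f (E' : 𝔸)) (B6Geom246MultiLevelBox.blkOf x.D.toDomains z) n)
      (exists_ball_bound_eLatS x O (cfg c) f _ n) E
  -- the printed scale at `z`
  have hlen : ∀ z : SiteY x.toKIdx, (geo9Y x).len (blkC x.toKIdx ιB z) = ((ℓ : ℝ) + 1) ^ (x.D.lev z.1) * |x.cf|⁻¹ := len_blkC_eq x ιB hι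
  have hlen0 : ∀ z : SiteY x.toKIdx, 0 < ((ℓ : ℝ) + 1) ^ (x.D.lev z.1) * |x.cf|⁻¹ := fun z => by
    rw [← hlen z]; exact geo9Y_len_pos x _
  revert hKe
  match n with
  | 0 =>
    intro hKe
    show (⨆ E : BallY 𝔸, wNormSY x.toKIdx (2 + γ) (fun z => ((etaS x.toKIdx ^ 2 : ℝ) : ℂ) • O (cfg c) (liftY f (E : 𝔸)) z)) ≤ C
    refine Real.iSup_le (fun E => wNormSY_le_of_pointwise x.toKIdx hC fun z => ?_) hC
    rw [norm_real_smul_eq (pow_nonneg hη0.le 2)]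
    have h1 : ‖O (cfg c) (liftY f (E : 𝔸)) z‖ ≤ eLatS x.toKIdx O (cfg c) (liftY f (E : 𝔸)) (B6Geom246MultiLevelBox.blkOf x.D.toDomains z) 0 :=
      norm_le_supBlkS x.toKIdx _ _ rfl
    have h2 := hKe z E
    have hp : B9.pref4 ((geo9Y x).len (blkC x.toKIdx ιB z)) 0 = (geo9Y x).len (blkC x.toKIdx ιB z) ^ 2 := rfl
    have he : epow 0 = 2 := rfl
    rw [hp, he, hlen z] at h2
    have hsplit : (((ℓ : ℝ) + 1) ^ (x.D.lev z.1) * |x.cf|⁻¹) ^ (2 + γ) =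
        (((ℓ : ℝ) + 1) ^ (x.D.lev z.1) * |x.cf|⁻¹) ^ 2 * (((ℓ : ℝ) + 1) ^ (x.D.lev z.1) * |x.cf|⁻¹) ^ γ := by
      rw [Real.rpow_add (hlen0 z), Real.rpow_two]
    rw [hsplit, ← mul_assoc]
    exact (mul_le_mul_of_nonneg_left h1 (pow_nonneg hη0.le 2)).trans h2
  | 1 =>
    intro hKe
    show (⨆ E : BallY 𝔸, ⨆ μ : Fin (d + 1),
      wNormSY x.toKIdx (1 + γ) (fun z => ((etaS x.toKIdx : ℝ) : ℂ) • cdS x.toKIdx (cfg c) μ (O (cfg c) (liftY f (E : 𝔸))) z)) ≤ C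
    refine Real.iSup_le (fun E => Real.iSup_le (fun μ => wNormSY_le_of_pointwise x.toKIdx hC fun z => ?_) hC) hC
    rw [norm_real_smul_eq hη0.le]
    have h1 : ‖cdS x.toKIdx (cfg c) μ (O (cfg c) (liftY f (E : 𝔸))) z‖ ≤
        eLatS x.toKIdx O (cfg c) (liftY f (E : 𝔸)) (B6Geom246MultiLevelBox.blkOf x.D.toDomains z) 1 :=
      norm_le_supBlkS' x.toKIdx _ (fun μ => cdS x.toKIdx (cfg c) μ (O (cfg c) (liftY f (E : 𝔸)))) μ rfl
    have h2 := hKe z E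
    have hp : B9.pref4 ((geo9Y x).len (blkC x.toKIdx ιB z)) 1 = (geo9Y x).len (blkC x.toKIdx ιB z) := rfl
    have he : epow 1 = 1 := rfl
    rw [hp, he, hlen z, pow_one] at h2
    have hsplit : (((ℓ : ℝ) + 1) ^ (x.D.lev z.1) * |x.cf|⁻¹) ^ (1 + γ) =
        (((ℓ : ℝ) + 1) ^ (x.D.lev z.1) * |x.cf|⁻¹) * (((ℓ : ℝ) + 1) ^ (x.D.lev z.1) * |x.cf|⁻¹) ^ γ := by
      rw [Real.rpow_add (hlen0 z), Real.rpow_one]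
    rw [hsplit, ← mul_assoc]
    exact (mul_le_mul_of_nonneg_left h1 hη0.le).trans h2
  | 2 =>
    intro hKe
    show (⨆ E : BallY 𝔸, ⨆ μ : Fin (d + 1),
      wNormSY x.toKIdx (1 + γ) (fun z => ((etaS x.toKIdx : ℝ) : ℂ) • O (cfg c) (cdsS x.toKIdx (cfg c) μ (liftY f (E : 𝔸))) z)) ≤ C
    refine Real.iSup_le (fun E => Real.iSup_le (fun μ => wNormSY_le_of_pointwise x.toKIdx hC fun z => ?_) hC) hC
    rw [norm_real_smul_eq hη0.le]
    have h1 : ‖O (cfg c) (cdsS x.toKIdx (cfg c) μ (liftY f (E : 𝔸))) z‖ ≤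
        eLatS x.toKIdx O (cfg c) (liftY f (E : 𝔸)) (B6Geom246MultiLevelBox.blkOf x.D.toDomains z) 2 :=
      norm_le_supBlkS' x.toKIdx _ (fun μ => O (cfg c) (cdsS x.toKIdx (cfg c) μ (liftY f (E : 𝔸)))) μ rfl
    have h2 := hKe z E
    have hp : B9.pref4 ((geo9Y x).len (blkC x.toKIdx ιB z)) 2 = (geo9Y x).len (blkC x.toKIdx ιB z) := rfl
    have he : epow 2 = 1 := rfl
    rw [hp, he, hlen z, pow_one] at h2
    have hsplit : (((ℓ : ℝ) + 1) ^ (x.D.lev z.1) * |x.cf|⁻¹) ^ (1 + γ) =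
        (((ℓ : ℝ) + 1) ^ (x.D.lev z.1) * |x.cf|⁻¹) * (((ℓ : ℝ) + 1) ^ (x.D.lev z.1) * |x.cf|⁻¹) ^ γ := by
      rw [Real.rpow_add (hlen0 z), Real.rpow_one]
    rw [hsplit, ← mul_assoc]
    exact (mul_le_mul_of_nonneg_left h1 hη0.le).trans h2
  | 3 =>
    intro hKe
    show (⨆ E : BallY 𝔸, wNormSY x.toKIdx γ (lapS x.toKIdx (cfg c) (O (cfg c) (liftY f (E : 𝔸))))) ≤ C
    refine Real.iSup_le (fun E => wNormSY_le_of_pointwise x.toKIdx hC fun z => ?_) hC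
    have h1 : ‖lapS x.toKIdx (cfg c) (O (cfg c) (liftY f (E : 𝔸))) z‖ ≤
        eLatS x.toKIdx O (cfg c) (liftY f (E : 𝔸)) (B6Geom246MultiLevelBox.blkOf x.D.toDomains z) 3 :=
      norm_le_supBlkS x.toKIdx _ _ rfl
    have h2 := hKe z E
    have hp : B9.pref4 ((geo9Y x).len (blkC x.toKIdx ιB z)) 3 = 1 := rfl
    have he : epow 3 = 0 := rfl
    rw [hp, he, hlen z, pow_zero, one_mul, mul_one] at h2
    exact h1.trans h2

end GlobLe

/-! ## §4 ★★ The reading axioms and (3.47) from (3.42) for `kernelFamilyS` -/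

section Main

variable (x : MemberY d ℓ hd hL b₀ b₁ Mstar) (ιB : BlkY x.toKIdx → IBondY x.toKIdx)

/-- ★★ **THE READING AXIOMS `GlobReading` HOLD FOR `kernelFamilyS` ON THE SITE ARGUMENTS**, block pieces `resY ιB`, at a member with a section `ιB` of `β`,
every `B`, `cfg`, `O`, `par`, every configuration. [cite: Balaban1985BackgroundPropagators, (3.41)–(3.42) p.397, (3.47) p.398; Balaban1984PropagatorsII, (2.52) p.232] -/
theorem globReading_kernelFamilyS [Fintype (geo9Y x).Site] (hι : ∀ s : BlkY x.toKIdx, β x.toKIdx.hN x.toKIdx.D x.toKIdx.hk (ιB s) = s)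
    (B : B9.Backgrounds) (cfg : B.Cfg → CfgY 𝔸 x.toKIdx) (O : SiteOpY 𝔸 x.toKIdx) (par : SiteParY 𝔸 x.toKIdx) (c : B.Cfg) :
    GlobReading (g := geo9Y x) (kernelFamilyS x.toKIdx B cfg O par) (fun lam => ∃ f, lam = Sum.inl f) c (resY x ιB) where
  res_P := by
    rintro b lam ⟨f, rfl⟩
    exact ⟨pieceY x ιB b f, rfl⟩
  res_supp := by
    rintro b lam ⟨f, rfl⟩
    exact suppIn_pieceY x ιB hι b f
  res_norm := by
    rintro b lam γ ⟨f, rfl⟩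
    exact supNorm_pieceY_le x ιB hι b f γ
  e_subadd := by
    rintro n lam y ⟨f, rfl⟩
    exact e_subadd_kernelFamilyS x ιB B cfg O par c n f y
  glob_le := by
    rintro n lam γ C ⟨f, rfl⟩ hC h
    exact glob_le_kernelFamilyS x ιB hι B cfg O par c n f γ C hC h

/-- ★★ **(3.47) FROM (3.42) FOR `kernelFamilyS`, ONE THRESHOLD PER RATE**: for every `δ₀ > 0` there are `Mg` and `Cg ≥ 0` ([4] Lemma 2.1 on the window
`{δ₀} × [1/2, 1]` at the geometry of record with `R` read as `1`, and the size condition `8·log L ≦ δ₀·M`) such that at every member with a section of `β`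
above `Mg`, for every backgrounds record, decoding, operator, transporter, configuration and `B₀ ≥ 0`:
`EBlock (kernelFamilyS …) B₀ δ₀ c → GlobBlock (kernelFamilyS …) (B₀·Cg) c`. [cite: Balaban1985BackgroundPropagators, (3.42) p.397, (3.47) p.398 («consequences of the local ones (3.42) and Lemma 2.1»); Balaban1984PropagatorsII, Lemma 2.1 (2.60)–(2.61) p.234] -/
theorem globBlock_kernelFamilyS_of_eBlock [∀ x : MemberY d ℓ hd hL b₀ b₁ Mstar, Fintype (geo9Y x).Site] {δ₀ : ℝ} (hδ₀ : 0 < δ₀) :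
    ∃ Mg Cg : ℝ, 0 ≤ Cg ∧
      ∀ (x : MemberY d ℓ hd hL b₀ b₁ Mstar) (ιB : BlkY x.toKIdx → IBondY x.toKIdx),
        (∀ s : BlkY x.toKIdx, β x.toKIdx.hN x.toKIdx.D x.toKIdx.hk (ιB s) = s) → Mg ≤ (geo9Y x).M →
        ∀ (B : B9.Backgrounds) (cfg : B.Cfg → CfgY 𝔸 x.toKIdx) (O : SiteOpY 𝔸 x.toKIdx) (par : SiteParY 𝔸 x.toKIdx) (c : B.Cfg) (B₀ : ℝ),
          0 ≤ B₀ → EBlock (kernelFamilyS x.toKIdx B cfg O par) B₀ δ₀ c → GlobBlock (kernelFamilyS x.toKIdx B cfg O par) (B₀ * Cg) c := by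
  obtain ⟨dB, ML, hW⟩ := lemma21Window_geo9Y (d := d) (ℓ := ℓ) (hd := hd) (hL := hL) (b₀ := b₀) (b₁ := b₁) (Mstar := Mstar)
    (fun _ => True) (δlo := δ₀) (δhi := δ₀) (αlo := 1 / 2) hδ₀ le_rfl (by norm_num)
  refine ⟨max ML (8 * Real.log ((ℓ : ℝ) + 1) / δ₀), B6.c1 dB δ₀ (1 - 1 / 2) * ((ℓ : ℝ) + 1) ^ (4 : ℝ),
    mul_nonneg (B6RandomWalk.c1_nonneg _ _ _) (Real.rpow_nonneg (by positivity) _), ?_⟩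
  intro x ιB hι hM B cfg O par c B₀ hB₀ hE
  have hML : ML ≤ (geo9Y x).M := le_trans (le_max_left _ _) hM
  obtain ⟨h260, h261⟩ := hW x δ₀ (1 / 2) le_rfl le_rfl le_rfl (by norm_num) hML
  have hLe : (geo9Y x).L = (ℓ : ℝ) + 1 := by show (((ℓ + 1 : ℕ) : ℝ)) = _; push_cast; rfl
  have hL1 : 1 ≤ (geo9Y x).L := geo9K_one_le_L x.toKIdx
  have hη : 0 < (geo9Y x).eta := geo9K_eta_pos x.toKIdx
  have hsize : 4 * Real.log (geo9Y x).L ≤ 1 / 2 * δ₀ * (1 : ℝ) * (geo9Y x).M := by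
    have h2 : 8 * Real.log ((ℓ : ℝ) + 1) / δ₀ ≤ (geo9Y x).M := le_trans (le_max_right _ _) hM
    rw [div_le_iff₀ hδ₀] at h2
    rw [hLe]
    linarith
  have h261' : Ineq261 dB (toB6 (geo9Y x) 1 True) δ₀ (1 - 1 / 2) := by norm_num; exact h261
  have hG := globBlockOn_of_eBlock (g := geo9Y x) (R := (1 : ℝ)) (H := True) (globReading_kernelFamilyS x ιB hι B cfg O par c) dB hB₀ hL1 hη
    (fun γ lam => geo9K_wNorm_nonneg x.toKIdx γ lam) hsize h260 h261' hE
  rw [hLe] at hG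
  intro n lam γ h1 h2
  cases lam with
  | inl f =>
    show (kernelFamilyS x.toKIdx B cfg O par).glob n c (.inl f) γ ≤
      B₀ * (B6.c1 dB δ₀ (1 - 1 / 2) * ((ℓ : ℝ) + 1) ^ (4 : ℝ)) * (geo9Y x).wNorm γ (.inl f)
    have := hG n (.inl f) γ ⟨f, rfl⟩ h1 h2
    rw [← mul_assoc]
    exact this
  | inr J =>
    have h0 : (kernelFamilyS x.toKIdx B cfg O par).glob n c (.inr J) γ = 0 := rfl
    rw [h0]
    exact mul_nonneg (mul_nonneg hB₀ (mul_nonneg (B6RandomWalk.c1_nonneg _ _ _) (Real.rpow_nonneg (by positivity) _)))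
      (geo9K_wNorm_nonneg x.toKIdx γ _)

end Main

end Literature.MathematicalPhysics.QuantumFieldTheory.Balaban1983to89.B9Ineq347SiteReadingY
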